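import Summits.QuantumFields.YangMills.Theorems.BalabanUVNodesN15KingModelToronOperator
import Summits.QuantumFields.YangMills.Theorems.BalabanUVNodesN15KingModelCovariantDeterminantBounds
import HarnessLib

/-!
# BalabanUVNodes ∕ N15 — THE KING-MODEL RUNG (PART Ͷ-b): THE TORON COVARIANCE IN TWISTED PLANE WAVES —
# `(−cΔ_ω + m²)⁻¹(x,y) = |T|⁻¹ Σ_q e^{iq·(x−y)} ∕ lapSymTw(φ,q)` (`ω = e^{iφ}`), its diagonal, and KATO's INEQUALITY ∕ DIAMAGNETISM OF THE DETERMINANT READ AS TWO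
# TRIGONOMETRIC INEQUALITIES ON THE SHIFTED MOMENTUM GRID: `Σ_q lapSymTw(φ,q)⁻¹ ≤ Σ_q lapSym(q)⁻¹`, `Π_q lapSym(q) ≤ Π_q lapSymTw(φ,q)`
# (Track A, DAG node N15 = NE2; FAN-OUT v1.1 §N15 s3 «KING-MODEL RUNG … + what the curved case adds»; count-neutral)

HONEST FRAMING.  Count-neutral (cell `pub-ymgap`, seat `pub-ymgap-dag-n15-e` g44; `--supports stmt-QuantumFields-27247 --as helper` = K3ᴬ, KEY MAP v3).  One finite torus at
fixed spacing; King's `A = 0` model [King1986] is the comparison object; constant abelian (flat) `U(1)` link fields only.  NOT Bałaban's `G_k(U)`, NOT [Balaban1985BackgroundPropagators]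
(3.42); NOT a node discharge (N15 of record untouched); nothing continuum ∕ ℝ⁴ ∕ OS ∕ Clay.

THE RESULTS (every period vector `K`, `c ≥ 0`, `m² > 0`, every phase vector `φ`; `M = toronOp K c m² (e^{iφ})` of PART Ͷ-a, `lapSymTw` its twisted symbol):
* §1 `toronKernel c m² K φ x y := |T|⁻¹Σ_q lapSymTw(φ,q)⁻¹·e^{iq·(x−y)}`; `toronKernel_zero` (at `φ = 0` it IS PART Ε-e's `kingPlaneWave`, King's (4.4)∕(4.35) covariance); ★★ `toronOp_mulVec_toronKernel_col`
  (`M·G(·,y) = δ_y`, character orthogonality `sum_chi_left`); ★★★ **`toronOp_inv_eq_toronKernel`** — THE TORON COVARIANCE IN TWISTED PLANE WAVES `(−cΔ_ω+m²)⁻¹(x,y) =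
  |T|⁻¹Σ_q e^{iq·(x−y)}∕(m² + cΣ_μ(2 − 2cos(p′_μ(q)+φ_μ)))`; ★★ `covLapF_toronLink_inv_apply` (PART Ͱ's covariant fine covariance at the toron field, entrywise);
* §2 `toronKernel_transl` (translation invariant), `conj_toronKernel` (Hermitian), the DIAGONAL `toronDiag c m² K φ := |T|⁻¹Σ_q lapSymTw(φ,q)⁻¹` (`toronKernel_diag`: real, the same at every
  site), ★ `norm_toronKernel_le_toronDiag` (`|G(x,y)| ≤ G(x,x)`), `toronDiag_pos`, ★ `toronDiag_le_inv_mass` (`≤ 1∕m²`), ★ `inv_le_toronDiag` (`≥ 1∕(m²+4c(d+1))`);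
* §3 BY NAME FROM PART Ͱ: ★★ `norm_toronKernel_le_lapF_inv` (Ͱ-b's Kato domination at `U = toronLink ω`: `|G_φ(x,y)| ≤ (lapF)⁻¹(x,y)`), hence ★★★ **`sum_inv_lapSymTw_le_sum_inv_lapSym`** —
  KATO ON THE DIAGONAL IS THE TRIGONOMETRIC INEQUALITY `Σ_q (m² + cΣ_μ(2−2cos(p′_μ(q)+φ_μ)))⁻¹ ≤ Σ_q (m² + cΣ_μ(2−2cos p′_μ(q)))⁻¹` (the mean inverse symbol over the SHIFTED
  momentum grid is maximal at zero shift); ★★ `det_toronOp_eq_prod` (`det M = Π_q lapSymTw(φ,q)`), and with Ͱ-c's diamagnetic inequality `det lapF ≤ Re det M_U` and PART Ε-k's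
  `det lapF = Π_q lapSym(q)`: ★★★ **`prod_lapSym_le_prod_lapSymTw`** — DIAMAGNETISM OF THE DETERMINANT IS `Π_q lapSym(q) ≤ Π_q lapSymTw(φ,q)`.
  WHAT THE CURVED CASE ADDS, EXACTLY: the holonomy moves King's momentum grid `p′ ∈ (2π∕K)ℤ^{d+1}` rigidly by `φ`; every magnitude statement of King's survives (§2, and Ͱ-b∕Ͱ-e in
  general), and the two aggregate comparisons with `φ = 0` are the displayed inequalities.

PRIOR TREE ART (by name, not restated): Ͷ-a (`toronOp`, `toronLink`, `lapSymTw`, `lapSymTw_zero∕_pos∕_ge∕_le`, `toronOp_mulVec_chi`, `toronOp_twistOf_eq_spectral`, `toronOp_inv_apply`,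
`norm_twistOf_eq_one`, `toronLink_mem_unitaryGroup`), Ͱ-b `norm_inv_entry_le_lapF_inv`, Ͱ-c `det_lapF_pow_le_re_det_covLapF`, Ε-e (`kingPlaneWave`, `lapF_inv_diag_eq`, `norm_chi_eq_one`),
Ε-k `det_lapF_eq_prod_lapSym`, `B5Prop11Plancherel` (`chi`, `chi_add_right`, `dft`, `dft_mem_unitaryGroup`), `King1986.Torus` (`sum_chi_left`, `chi_neg_left`, `conj_chi`), `B5LaplaceInverse`
(`dft_conjTranspose_mul`).  Dedup (rg at filing): basename 0 files; needles `toronKernel|toronDiag|sum_inv_lapSymTw_le|prod_lapSym_le_prod_lapSymTw|det_toronOp` 0 tree files.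
Locators: [King1986] (4.4) p.670, (4.35) p.674, (3.89) p.668; [Balaban1985BackgroundPropagators] (3.23) p.394, (3.42) p.397; [Balaban1984PropagatorsI] (1.29)∕(1.31) p.23;
[DodziukMathai2006] §1 Thm 1.5; [Balaban1982Higgs2] (3.38) p.591.  0 `sorry`, 2 `def` (`toronKernel`, `toronDiag`).
-/

noncomputable section

open scoped BigOperators ComplexConjugate ComplexOrder
open Finset Matrix Complex

namespace Summit.QuantumFields.YangMills.BalabanUVNodes.N15KingModelRung.Toron

open Literature.MathematicalPhysics.QuantumFieldTheory.LatticeDiamagneticInequality (Hopping)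
open Literature.MathematicalPhysics.QuantumFieldTheory.Balaban1983to89.B5Prop11Plancherel
open Literature.MathematicalPhysics.QuantumFieldTheory.Balaban1983to89.B5LaplaceInverse (dft_conjTranspose_mul dft_mul_conjTranspose)
open Literature.MathematicalPhysics.QuantumFieldTheory.Balaban1983to89.B5ToronMomentum161 (twistOf)
open Literature.MathematicalPhysics.QuantumFieldTheory.King1986.Torus (lapF lapSym sum_chi_left chi_neg_left lapSym_ge)
open Summit.QuantumFields.YangMills.BalabanUVNodes.N15KingModelRung.Covariant (covLapF norm_inv_entry_le_lapF_inv det_lapF_pow_le_re_det_covLapF)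
open Summit.QuantumFields.YangMills.BalabanUVNodes.N15KingModelRung.TorusSpectral (kingPlaneWave lapF_inv_diag_eq norm_chi_eq_one det_lapF_eq_prod_lapSym)

variable {d : ℕ} (K : Fin (d + 1) → ℕ) [hK : ∀ μ, NeZero (K μ)]

/-! ## §1 The twisted plane-wave kernel inverts the toron operator -/

section Kernel

/-- THE TWISTED PLANE-WAVE KERNEL `|T|⁻¹Σ_q lapSymTw(φ,q)⁻¹·e^{iq·(x−y)}` — King's (4.4)∕(4.35) plane-wave covariance with the symbol at the shifted momenta.
[cite: King1986, (4.4) p.670, (4.35) p.674; Balaban1984PropagatorsI, (1.31) p.23] -/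
def toronKernel (c m2 : ℝ) (φ : Fin (d + 1) → ℝ) (x y : Tor K) : ℂ :=
  (Fintype.card (Tor K) : ℂ)⁻¹ * ∑ q : Tor K, (((lapSymTw K c m2 φ q)⁻¹ : ℝ) : ℂ) * chi K q (x - y)

/-- RECOVERY: at `φ = 0` the twisted kernel IS PART Ε-e's `kingPlaneWave` (King's `A = 0` torus covariance in plane waves). [cite: King1986, (4.4) p.670] -/
theorem toronKernel_zero (c m2 : ℝ) (x y : Tor K) : toronKernel K c m2 0 x y = kingPlaneWave c m2 K x y := by
  simp only [toronKernel, kingPlaneWave, lapSymTw_zero]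

/-- The card of the torus is a non-zero complex number. [folklore] -/
theorem card_tor_ne_zero : (Fintype.card (Tor K) : ℂ) ≠ 0 := by
  exact_mod_cast Fintype.card_ne_zero

/-- ★★ THE COLUMN EQUATION `M·G(·,y) = δ_y`: plane waves are eigenvectors (Ͷ-a) and characters are orthogonal. [cite: King1986, (4.35) p.674] -/
theorem toronOp_mulVec_toronKernel_col {c m2 : ℝ} (hc : 0 ≤ c) (hm : 0 < m2) (φ : Fin (d + 1) → ℝ) (y : Tor K) :
    toronOp K c m2 (twistOf φ) *ᵥ (fun z => toronKernel K c m2 φ z y) = fun x => if x = y then 1 else 0 := by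
  have hcol : (fun z => toronKernel K c m2 φ z y)
      = ∑ q : Tor K, ((Fintype.card (Tor K) : ℂ)⁻¹ * (((lapSymTw K c m2 φ q)⁻¹ : ℝ) : ℂ) * chi K q (-y)) • chi K q := by
    funext z
    simp only [toronKernel, Finset.sum_apply, Pi.smul_apply, smul_eq_mul, Finset.mul_sum]
    refine Finset.sum_congr rfl fun q _ => ?_
    rw [sub_eq_add_neg, chi_add_right]; ring
  rw [hcol, Matrix.mulVec_sum]
  simp_rw [Matrix.mulVec_smul, toronOp_mulVec_chi]
  funext x
  simp only [Finset.sum_apply, Pi.smul_apply, smul_eq_mul]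
  have hq : ∀ q : Tor K, (Fintype.card (Tor K) : ℂ)⁻¹ * (((lapSymTw K c m2 φ q)⁻¹ : ℝ) : ℂ) * chi K q (-y) * (((lapSymTw K c m2 φ q : ℝ) : ℂ) * chi K q x)
      = (Fintype.card (Tor K) : ℂ)⁻¹ * chi K q (x - y) := by
    intro q
    have hne : ((lapSymTw K c m2 φ q : ℝ) : ℂ) ≠ 0 := by exact_mod_cast (lapSymTw_pos K hc hm φ q).ne'
    rw [sub_eq_add_neg, chi_add_right]
    push_cast
    field_simp
  simp_rw [hq]
  rw [← Finset.mul_sum, sum_chi_left]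
  by_cases h : x = y
  · subst h; rw [sub_self, if_pos rfl, if_pos rfl, inv_mul_cancel₀ (card_tor_ne_zero K)]
  · rw [if_neg (sub_ne_zero.mpr h), if_neg h, mul_zero]

/-- `M·G = 1` (matrix form). [cite: King1986, (4.35) p.674] -/
theorem toronOp_mul_toronKernel {c m2 : ℝ} (hc : 0 ≤ c) (hm : 0 < m2) (φ : Fin (d + 1) → ℝ) :
    toronOp K c m2 (twistOf φ) * Matrix.of (toronKernel K c m2 φ) = 1 := by
  ext x y
  have h := congr_fun (toronOp_mulVec_toronKernel_col K hc hm φ y) x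
  rw [Matrix.mul_apply', Matrix.one_apply]
  simpa only [Matrix.mulVec, dotProduct, Matrix.of_apply] using h

/-- ★★★ **THE TORON COVARIANCE IN TWISTED PLANE WAVES**: `(−cΔ_ω + m²)⁻¹ = (|T|⁻¹Σ_q lapSymTw(φ,q)⁻¹e^{iq·(x−y)})_{x,y}` (`ω = e^{iφ}`, `c ≥ 0`, `m² > 0`).
[cite: King1986, (4.4) p.670, (4.35) p.674; Balaban1984PropagatorsI, (1.29)-(1.31) p.23; Balaban1985BackgroundPropagators, (3.23) p.394] -/
theorem toronOp_inv_eq_toronKernel {c m2 : ℝ} (hc : 0 ≤ c) (hm : 0 < m2) (φ : Fin (d + 1) → ℝ) :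
    (toronOp K c m2 (twistOf φ))⁻¹ = Matrix.of (toronKernel K c m2 φ) :=
  Matrix.inv_eq_right_inv (toronOp_mul_toronKernel K hc hm φ)

/-- Entries: `(−cΔ_ω+m²)⁻¹(x,y) = |T|⁻¹Σ_q lapSymTw(φ,q)⁻¹e^{iq·(x−y)}`. [cite: King1986, (4.35) p.674] -/
theorem toronOp_inv_apply_eq {c m2 : ℝ} (hc : 0 ≤ c) (hm : 0 < m2) (φ : Fin (d + 1) → ℝ) (x y : Tor K) :
    (toronOp K c m2 (twistOf φ))⁻¹ x y = toronKernel K c m2 φ x y := by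
  rw [toronOp_inv_eq_toronKernel K hc hm]; rfl

/-- ★★ **PART Ͱ's COVARIANT FINE COVARIANCE AT THE TORON FIELD, ENTRYWISE**: `(covLapF K c m² (toronLink e^{iφ}))⁻¹((x,()),(y,())) = |T|⁻¹Σ_q lapSymTw(φ,q)⁻¹e^{iq·(x−y)}`.
[cite: Balaban1985BackgroundPropagators, (3.23) p.394; King1986, (4.35) p.674] -/
theorem covLapF_toronLink_inv_apply {c m2 : ℝ} (hc : 0 ≤ c) (hm : 0 < m2) (φ : Fin (d + 1) → ℝ) (x y : Tor K) :
    (covLapF K c m2 (toronLink K (twistOf φ)))⁻¹ (x, ()) (y, ()) = toronKernel K c m2 φ x y := by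
  rw [← toronOp_inv_apply, toronOp_inv_apply_eq K hc hm]

end Kernel

/-! ## §2 Translation invariance, Hermitian symmetry, the diagonal -/

section Diagonal

/-- Translation invariance: `G(x+t, y+t) = G(x,y)` (a constant link field is translation invariant). [cite: King1986, (4.4) p.670] -/
theorem toronKernel_transl (c m2 : ℝ) (φ : Fin (d + 1) → ℝ) (x y t : Tor K) : toronKernel K c m2 φ (x + t) (y + t) = toronKernel K c m2 φ x y := by
  simp only [toronKernel, add_sub_add_right_eq_sub]

/-- Hermitian symmetry: `conj G(x,y) = G(y,x)`. [cite: Balaban1985BackgroundPropagators, (3.23) p.394] -/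
theorem conj_toronKernel (c m2 : ℝ) (φ : Fin (d + 1) → ℝ) (x y : Tor K) : conj (toronKernel K c m2 φ x y) = toronKernel K c m2 φ y x := by
  simp only [toronKernel, map_mul, map_sum, map_inv₀, map_natCast, Complex.conj_ofReal]
  congr 1
  refine Finset.sum_congr rfl fun q _ => ?_
  rw [conj_chi, chi_neg_left, neg_sub]

/-- THE DIAGONAL VALUE `|T|⁻¹Σ_q lapSymTw(φ,q)⁻¹` (a real number, the same at every site). [cite: King1986, (4.35) p.674] -/
def toronDiag (c m2 : ℝ) (φ : Fin (d + 1) → ℝ) : ℝ := (Fintype.card (Tor K) : ℝ)⁻¹ * ∑ q : Tor K, (lapSymTw K c m2 φ q)⁻¹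

/-- `G(x,x) = toronDiag` at every site. [cite: King1986, (4.35) p.674] -/
theorem toronKernel_diag (c m2 : ℝ) (φ : Fin (d + 1) → ℝ) (x : Tor K) : toronKernel K c m2 φ x x = ((toronDiag K c m2 φ : ℝ) : ℂ) := by
  simp only [toronKernel, toronDiag, sub_self, Literature.MathematicalPhysics.QuantumFieldTheory.Balaban1983to89.B5Block118.chi_zero_right, mul_one]
  push_cast
  rfl

/-- ★ THE DIAGONAL DOMINATES: `|G(x,y)| ≤ toronDiag` (`|e^{iq·w}| = 1`, all summands of the diagonal are positive). [cite: King1986, (4.35) p.674] -/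
theorem norm_toronKernel_le_toronDiag {c m2 : ℝ} (hc : 0 ≤ c) (hm : 0 < m2) (φ : Fin (d + 1) → ℝ) (x y : Tor K) :
    ‖toronKernel K c m2 φ x y‖ ≤ toronDiag K c m2 φ := by
  unfold toronKernel toronDiag
  rw [norm_mul, norm_inv, Complex.norm_natCast]
  refine mul_le_mul_of_nonneg_left (le_trans (norm_sum_le _ _) (Finset.sum_le_sum fun q _ => ?_)) (inv_nonneg.mpr (Nat.cast_nonneg _))
  rw [norm_mul, norm_chi_eq_one, mul_one, Complex.norm_real, Real.norm_eq_abs, abs_of_pos (inv_pos.mpr (lapSymTw_pos K hc hm φ q))]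

/-- `toronDiag > 0`. [cite: King1986, (4.35) p.674] -/
theorem toronDiag_pos {c m2 : ℝ} (hc : 0 ≤ c) (hm : 0 < m2) (φ : Fin (d + 1) → ℝ) : 0 < toronDiag K c m2 φ := by
  unfold toronDiag
  have hcard : (0 : ℝ) < Fintype.card (Tor K) := by exact_mod_cast Fintype.card_pos
  exact mul_pos (inv_pos.mpr hcard) (Finset.sum_pos (fun q _ => inv_pos.mpr (lapSymTw_pos K hc hm φ q)) Finset.univ_nonempty)

/-- ★ `toronDiag ≤ 1∕m²` (every symbol value is `≥ m²`). [cite: King1986, (4.4) p.670] -/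
theorem toronDiag_le_inv_mass {c m2 : ℝ} (hc : 0 ≤ c) (hm : 0 < m2) (φ : Fin (d + 1) → ℝ) : toronDiag K c m2 φ ≤ m2⁻¹ := by
  unfold toronDiag
  have hcard : (0 : ℝ) < Fintype.card (Tor K) := by exact_mod_cast Fintype.card_pos
  have h : ∑ q : Tor K, (lapSymTw K c m2 φ q)⁻¹ ≤ ∑ _q : Tor K, m2⁻¹ :=
    Finset.sum_le_sum fun q _ => (inv_le_inv₀ (lapSymTw_pos K hc hm φ q) hm).mpr (lapSymTw_ge K hc m2 φ q)
  rw [Finset.sum_const, Finset.card_univ, nsmul_eq_mul] at h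
  calc (Fintype.card (Tor K) : ℝ)⁻¹ * ∑ q : Tor K, (lapSymTw K c m2 φ q)⁻¹ ≤ (Fintype.card (Tor K) : ℝ)⁻¹ * (Fintype.card (Tor K) * m2⁻¹) :=
        mul_le_mul_of_nonneg_left h (inv_nonneg.mpr hcard.le)
    _ = m2⁻¹ := by field_simp

/-- ★ `toronDiag ≥ 1∕(m² + 4c(d+1))` (every symbol value is `≤ m² + 4c(d+1)`). [cite: King1986, (4.4) p.670] -/
theorem inv_le_toronDiag {c m2 : ℝ} (hc : 0 ≤ c) (hm : 0 < m2) (φ : Fin (d + 1) → ℝ) : (m2 + 4 * c * ((d : ℝ) + 1))⁻¹ ≤ toronDiag K c m2 φ := by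
  unfold toronDiag
  have hcard : (0 : ℝ) < Fintype.card (Tor K) := by exact_mod_cast Fintype.card_pos
  have h : ∑ _q : Tor K, (m2 + 4 * c * ((d : ℝ) + 1))⁻¹ ≤ ∑ q : Tor K, (lapSymTw K c m2 φ q)⁻¹ :=
    Finset.sum_le_sum fun q _ => (inv_le_inv₀ (by positivity) (lapSymTw_pos K hc hm φ q)).mpr (lapSymTw_le K hc m2 φ q)
  rw [Finset.sum_const, Finset.card_univ, nsmul_eq_mul] at h
  calc (m2 + 4 * c * ((d : ℝ) + 1))⁻¹ = (Fintype.card (Tor K) : ℝ)⁻¹ * (Fintype.card (Tor K) * (m2 + 4 * c * ((d : ℝ) + 1))⁻¹) := by field_simp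
    _ ≤ _ := mul_le_mul_of_nonneg_left h (inv_nonneg.mpr hcard.le)

/-- The real part of the kernel is bounded by the diagonal too. [folklore] -/
theorem abs_re_toronKernel_le_toronDiag {c m2 : ℝ} (hc : 0 ≤ c) (hm : 0 < m2) (φ : Fin (d + 1) → ℝ) (x y : Tor K) :
    |(toronKernel K c m2 φ x y).re| ≤ toronDiag K c m2 φ :=
  le_trans (Complex.abs_re_le_norm _) (norm_toronKernel_le_toronDiag K hc hm φ x y)

end Diagonal

/-! ## §3 Kato's inequality and diamagnetism of the determinant as trigonometric inequalities -/

section Comparison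

/-- ★★ **KATO AT THE TORON, BY NAME** (PART Ͱ-b at `U = toronLink e^{iφ}`): `|(−cΔ_ω+m²)⁻¹(x,y)| ≤ (c(−Δ)+m²)⁻¹(x,y)` — every entry of the toron covariance is dominated by
King's `A = 0` covariance. [cite: DodziukMathai2006, Thm 1.5 §1; Balaban1985BackgroundPropagators, (3.42) p.397; King1986, (4.4) p.670] -/
theorem norm_toronKernel_le_lapF_inv {c m2 : ℝ} (hc : 0 ≤ c) (hm : 0 < m2) (φ : Fin (d + 1) → ℝ) (x y : Tor K) :
    ‖toronKernel K c m2 φ x y‖ ≤ (lapF K c m2)⁻¹ x y := by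
  rw [← covLapF_toronLink_inv_apply K hc hm]
  exact norm_inv_entry_le_lapF_inv K hc hm (toronLink_mem_unitaryGroup K (norm_twistOf_eq_one φ)) x y () ()

/-- ★★ ON THE DIAGONAL: `toronDiag(φ) ≤ (lapF)⁻¹(x,x)` — the toron's coincident-point covariance never exceeds King's. [cite: DodziukMathai2006, Thm 1.5 §1; King1986, (4.35) p.674] -/
theorem toronDiag_le_lapF_inv_diag {c m2 : ℝ} (hc : 0 ≤ c) (hm : 0 < m2) (φ : Fin (d + 1) → ℝ) (x : Tor K) :
    toronDiag K c m2 φ ≤ (lapF K c m2)⁻¹ x x := by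
  have h := norm_toronKernel_le_lapF_inv K hc hm φ x x
  rwa [toronKernel_diag, Complex.norm_real, Real.norm_eq_abs, abs_of_pos (toronDiag_pos K hc hm φ)] at h

/-- ★★★ **KATO ON THE DIAGONAL IS A TRIGONOMETRIC INEQUALITY ON THE SHIFTED GRID**: for every period vector, `c ≥ 0`, `m² > 0` and EVERY phase vector `φ`,
`Σ_q (m² + cΣ_μ(2 − 2cos(p′_μ(q) + φ_μ)))⁻¹ ≤ Σ_q (m² + cΣ_μ(2 − 2cos p′_μ(q)))⁻¹` — the mean inverse symbol over the rigidly shifted momentum grid is maximal at zero shift.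
[cite: DodziukMathai2006, Thm 1.5 §1; King1986, (4.4) p.670, (4.35) p.674] -/
theorem sum_inv_lapSymTw_le_sum_inv_lapSym {c m2 : ℝ} (hc : 0 ≤ c) (hm : 0 < m2) (φ : Fin (d + 1) → ℝ) :
    ∑ q : Tor K, (lapSymTw K c m2 φ q)⁻¹ ≤ ∑ q : Tor K, (lapSym K c m2 q)⁻¹ := by
  have hcard : (0 : ℝ) < Fintype.card (Tor K) := by exact_mod_cast Fintype.card_pos
  have h := toronDiag_le_lapF_inv_diag K hc hm φ 0
  rw [lapF_inv_diag_eq K hc hm, toronDiag] at h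
  exact le_of_mul_le_mul_left h (inv_pos.mpr hcard)

/-- ★★ **THE DETERMINANT OF THE TORON OPERATOR** is the product of the twisted symbol over the momentum grid: `det(−cΔ_ω+m²) = Π_q lapSymTw(φ,q)` (spectral form of Ͷ-a).
[cite: King1986, (3.89) p.668, (4.4) p.670] -/
theorem det_toronOp_eq_prod {c : ℝ} (hc : 0 ≤ c) (m2 : ℝ) (φ : Fin (d + 1) → ℝ) :
    (toronOp K c m2 (twistOf φ)).det = ∏ q : Tor K, ((lapSymTw K c m2 φ q : ℝ) : ℂ) := by
  rw [toronOp_twistOf_eq_spectral K hc, Matrix.det_mul, Matrix.det_mul, Matrix.det_diagonal]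
  have hU : (dft K)ᴴ.det * (dft K).det = 1 := by rw [← Matrix.det_mul, dft_conjTranspose_mul, Matrix.det_one]
  calc (dft K)ᴴ.det * (∏ q, ((lapSymTw K c m2 φ q : ℝ) : ℂ)) * (dft K).det = ((dft K)ᴴ.det * (dft K).det) * ∏ q, ((lapSymTw K c m2 φ q : ℝ) : ℂ) := by ring
    _ = _ := by rw [hU, one_mul]

/-- The determinant is real: `det M = Π_q lapSymTw(φ,q)` as a real number cast. [cite: King1986, (3.89) p.668] -/
theorem det_toronOp_eq_ofReal_prod {c : ℝ} (hc : 0 ≤ c) (m2 : ℝ) (φ : Fin (d + 1) → ℝ) :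
    (toronOp K c m2 (twistOf φ)).det = ((∏ q : Tor K, lapSymTw K c m2 φ q : ℝ) : ℂ) := by
  rw [det_toronOp_eq_prod K hc, Complex.ofReal_prod]

/-- The toron operator and PART Ͱ's `covLapF` at the toron field have the same determinant (reindexing). [folklore] -/
theorem det_covLapF_toronLink (c m2 : ℝ) (ω : Fin (d + 1) → ℂ) : (covLapF K c m2 (toronLink K ω)).det = (toronOp K c m2 ω).det := by
  rw [toronOp, Matrix.det_reindex_self]

/-- ★★★ **DIAMAGNETISM OF THE DETERMINANT IS A TRIGONOMETRIC INEQUALITY ON THE SHIFTED GRID**: for every period vector, `c ≥ 0`, `m² > 0` and EVERY phase vector `φ`,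
`Π_q (m² + cΣ_μ(2 − 2cos p′_μ(q))) ≤ Π_q (m² + cΣ_μ(2 − 2cos(p′_μ(q) + φ_μ)))` — PART Ͱ-c's `det(c(−Δ)+m²) ≤ det(−cΔ_U+m²)` ([BrydgesFrohlichSeiler1979] as invoked at
[Balaban1982Higgs2] (3.38)) at `U = toronLink e^{iφ}`, with both determinants diagonalised by plane waves. [cite: Balaban1982Higgs2, (3.38) p.591; King1986, (3.89) p.668, (4.4) p.670] -/
theorem prod_lapSym_le_prod_lapSymTw {c m2 : ℝ} (hc : 0 ≤ c) (hm : 0 < m2) (φ : Fin (d + 1) → ℝ) :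
    ∏ q : Tor K, lapSym K c m2 q ≤ ∏ q : Tor K, lapSymTw K c m2 φ q := by
  have h := det_lapF_pow_le_re_det_covLapF K (𝕜 := ℂ) (n := Unit) hc hm (toronLink_mem_unitaryGroup K (norm_twistOf_eq_one φ))
  rw [Fintype.card_unit, pow_one, det_lapF_eq_prod_lapSym, det_covLapF_toronLink, det_toronOp_eq_ofReal_prod K hc] at h
  simpa only [RCLike.re_to_complex, Complex.ofReal_re] using h

/-- The same for the FREE ENERGIES (logarithms): `Σ_q log lapSym(q) ≤ Σ_q log lapSymTw(φ,q)` — switching on a holonomy RAISES King's free-field normalisation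
`½log det`. [cite: King1986, (3.89) p.668; Balaban1982Higgs2, (3.38) p.591] -/
theorem sum_log_lapSym_le_sum_log_lapSymTw {c m2 : ℝ} (hc : 0 ≤ c) (hm : 0 < m2) (φ : Fin (d + 1) → ℝ) :
    ∑ q : Tor K, Real.log (lapSym K c m2 q) ≤ ∑ q : Tor K, Real.log (lapSymTw K c m2 φ q) := by
  have hpos0 : ∀ q : Tor K, 0 < lapSym K c m2 q := fun q => lt_of_lt_of_le hm (lapSym_ge K c m2 hc q)
  rw [← Real.log_prod (s := Finset.univ) (fun q _ => (hpos0 q).ne'), ← Real.log_prod (s := Finset.univ) (fun q _ => (lapSymTw_pos K hc hm φ q).ne')]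
  exact Real.log_le_log (Finset.prod_pos fun q _ => hpos0 q) (prod_lapSym_le_prod_lapSymTw K hc hm φ)

end Comparison

end Summit.QuantumFields.YangMills.BalabanUVNodes.N15KingModelRung.Toron

end
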